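import Literature.AlgebraicGeometry.Motives.SmoothHypersurfaceExistenceProofs
import Literature.AlgebraicGeometry.Motives.DworkFamily
import HarnessLib

/-!
# The Fermat hypersurface `V₊(x₀ᵐ + ⋯ + x_{n+1}ᵐ) ⊂ ℙⁿ⁺¹_k` over a field: the standard model, its smoothness, and uniqueness of the scheme cut out by a form

Family `hodge`, layer `Literature/AlgebraicGeometry/Motives`. Over an arbitrary field `k`, the
STANDARD MODEL of the Fermat variety `Xⁿₘ` (Shioda, Proc. Japan Acad. 55A (1979) §1 eq. (1);
Math. Ann. 245 (1979) §1) is the `k`-scheme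
`SmoothHypersurface.hypersurface (fermatPolynomial k n m)` of `Motives/SmoothHypersurfaceScheme`:
the zero locus `V₊(Σᵢ xᵢᵐ) ⊂ ℙⁿ⁺¹_k` with its reduced induced closed-subscheme structure
(Hartshorne II Example 3.2.6). This file PROVES, for every field `k`:

* `SmoothHypersurface.isHypersurfaceCutOutBy_self F`: for EVERY form `F`, `X_F = hypersurface F`
  is reduced and closed-immersed onto `V₊(F)` (`Motives.IsHypersurfaceCutOutBy (n + 1) F X_F`; the
  reducedness for arbitrary `F` is the tree's `instIsReducedLeftHypersurface`, `Motives/DworkFamily`),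
  whence `isFermatVariety_hypersurface_fermatPolynomial k n m : IsFermatVariety n m X` for the
  standard model and ALL `n, m`;
* `IsHypersurfaceCutOutBy.nonempty_iso`: **two `k`-schemes cut out by the same form are
  `k`-isomorphic** — uniqueness of the reduced induced structure (Hartshorne II Ex. 3.11 (d): a
  morphism from a reduced scheme whose image lies in a closed subscheme factors through it, the
  tree's `Motives.liftOfRangeSubset`, applied both ways); in particular every scheme cut out by `F`
  is isomorphic to `X_F` (`IsHypersurfaceCutOutBy.nonempty_iso_hypersurface`) and every Fermat
  variety to the standard model (`IsFermatVariety.nonempty_iso_hypersurface`,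
  `IsFermatVariety.nonempty_iso`);
* `SmoothHypersurface.isSmoothHypersurface_hypersurface_fermatPolynomial`: **the standard model is a
  smooth hypersurface of dimension `n` and degree `m`** (`Motives.IsSmoothHypersurface`: smooth
  projective geometrically irreducible, cut out by an irreducible form of degree `m`) as soon as
  `n ≥ 1`, `m ≥ 1`, `m ≠ 0` in `k` and `-1` is an `m`-th power in `k` — Jacobian criterion
  (`∂ᵢ = m xᵢ^{m-1}`, the tree's `isNonsingularForm_sum_X_pow`) and Eisenstein at the rational point
  `(ζ, 1, 0, …, 0)`, `ζᵐ = -1`, over every overfield (the tree's `irreducible_sum_X_pow`); Hartshorne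
  I Ex. 5.5, II Example 8.20.2, exactly the argument of the tree's
  `exists_isSmoothHypersurface_holds` (`Motives/SmoothHypersurfaceExistenceProofs`) with the witness
  named; corollaries for `k` algebraically closed (`…_of_isAlgClosed`, `m ≠ 0` in `k`;
  `…_of_charZero`), `isSmoothProjective_hypersurface_fermatPolynomial[_of_charZero]`, and for an
  abstract Fermat variety `IsFermatVariety.isSmoothHypersurface`.

## Relation to `HodgeTheory/FermatHypersurfaceReduction` (work item `defn-FermatLayerConeLightRehome`)

Over `k = ℂ` that file names the standard model `fermatHypersurface n m` — an `abbrev` for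
`SmoothHypersurface.hypersurface (fermatPolynomial ℂ n m)`, so every statement below applies to
`fermatHypersurface n m` by `rfl` — and proves `isSmoothHypersurface_fermatHypersurface`,
`isSmoothProjective_fermatHypersurface`, `isFermatVariety_fermatHypersurface` (`m ≥ 1`) and the
isomorphism `IsFermatVariety.isoFermatHypersurface`; but its imports carry the named facts of the
Hodge conjecture for Fermat varieties, Voisin's Hodge loci and the Hodge decomposition
(`FermatHodgeConjectureProofs`, `HodgeConjectureQbarVoisinProofs`, `ComplexConjugation`), which a
route about the standard model must not inherit. The fully-qualified names cannot be re-homed by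
a single-file proposal while 20 files use them, so this file states the results over a general
field under the statement-style names above; the `ℂ`-lemmas of `FermatHypersurfaceReduction` are
their specialisations. Imports: `Motives/SmoothHypersurfaceExistenceProofs`, `Motives/DworkFamily`
(no named fact beyond the cone of `Summits/HodgeConjecture/HodgeConjecture/Statement.lean`).

## References

* [Shioda1979PJA] T. Shioda, The Hodge conjecture and the Tate conjecture for Fermat varieties,
  Proc. Japan Acad. 55A (1979) 111–114, §1 eq. (1) (`Xⁿₘ(p)` "defined by the equation
  `x₀ᵐ + x₁ᵐ + ⋯ + x_{n+1}ᵐ = 0`" over a field of characteristic `p ∤ m`).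
* [Hartshorne1977] R. Hartshorne, Algebraic Geometry (1977), I Ex. 5.5, II Example 3.2.6,
  II Ex. 3.11 (d), II Example 8.20.2.
* [StacksProject] The Stacks project, Tag 0356 (maps from reduced schemes into closed subschemes).
-/

noncomputable section

open CategoryTheory AlgebraicGeometry MvPolynomial

universe u

namespace Literature.AlgebraicGeometry.Motives

variable {k : Type u} [Field k]

/-! ### Closed immersions of reduced schemes with the same image -/

section Uniqueness

variable {X X' Q : SchemeOver k} (j : X ⟶ Q) (j' : X' ⟶ Q)

/-- Two closed `k`-immersions `j : X → Q`, `j' : X' → Q` of REDUCED `k`-schemes with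
`range j = range j'` are isomorphic over `Q` (hence over `k`): each factors uniquely through the
other (`liftOfRangeSubset`). Hartshorne II Ex. 3.11 (d). (The same construction, over `ℂ` and as
a definition, is `isoOverOfClosedImmersionsOfRangeEq` of `HodgeTheory/FermatHypersurfaceReduction`.)
[cite: Hartshorne1977, II Ex. 3.11 (d)] -/
theorem exists_iso_hom_comp_eq_of_range_eq [IsClosedImmersion j.left] [IsClosedImmersion j'.left]
    [IsReduced X.left] [IsReduced X'.left] (h : Set.range j.left = Set.range j'.left) :
    ∃ e : X ≅ X', e.hom ≫ j' = j := by
  refine ⟨Over.isoMk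
    { hom := liftOfRangeSubset j'.left j.left h.le
      inv := liftOfRangeSubset j.left j'.left h.ge
      hom_inv_id := by
        rw [← cancel_mono j.left, Category.assoc, liftOfRangeSubset_comp, liftOfRangeSubset_comp,
          Category.id_comp]
      inv_hom_id := by
        rw [← cancel_mono j'.left, Category.assoc, liftOfRangeSubset_comp, liftOfRangeSubset_comp,
          Category.id_comp] }
    (by
      change liftOfRangeSubset j'.left j.left h.le ≫ X'.hom = X.hom
      rw [← Over.w j', liftOfRangeSubset_comp_assoc, Over.w j]), ?_⟩
  ext : 1
  rw [Over.comp_left]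
  exact liftOfRangeSubset_comp j'.left j.left h.le

attribute [local instance] MvPolynomial.gradedAlgebra

/-- **Two `k`-schemes cut out by the same form are `k`-isomorphic, compatibly with their
immersions into `ℙᴺ_k`**: if `X` and `X'` are reduced with closed `k`-immersions `ι`, `ι'` onto
`V₊(F) ⊂ ℙᴺ_k`, there is `e : X ≅ X'` over `k` with `e ≫ ι' = ι` (uniqueness of the reduced induced
structure, Hartshorne II Ex. 3.11 (d)). Here `ι`, `ι'` are ANY immersions witnessing
`IsHypersurfaceCutOutBy`. [cite: Hartshorne1977, II Ex. 3.11 (d)] -/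
theorem IsHypersurfaceCutOutBy.exists_iso_comp_eq {N : ℕ} {F : MvPolynomial (Fin (N + 1)) k}
    {X X' : SchemeOver k} (h : IsHypersurfaceCutOutBy N F X) (h' : IsHypersurfaceCutOutBy N F X')
    (ι : X ⟶ projectiveSpace N k) [IsClosedImmersion ι.left]
    (hι : Set.range ι.left =
      ProjectiveSpectrum.zeroLocus (MvPolynomial.homogeneousSubmodule (Fin (N + 1)) k) {F})
    (ι' : X' ⟶ projectiveSpace N k) [IsClosedImmersion ι'.left]
    (hι' : Set.range ι'.left =
      ProjectiveSpectrum.zeroLocus (MvPolynomial.homogeneousSubmodule (Fin (N + 1)) k) {F}) :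
    ∃ e : X ≅ X', e.hom ≫ ι' = ι := by
  haveI : IsReduced X.left := h.1
  haveI : IsReduced X'.left := h'.1
  exact exists_iso_hom_comp_eq_of_range_eq ι ι' (hι.trans hι'.symm)

/-- **Two `k`-schemes cut out by the same form are `k`-isomorphic** (uniqueness of the reduced
induced structure on `V₊(F)`, Hartshorne II Ex. 3.11 (d)). [cite: Hartshorne1977, II Ex. 3.11 (d)] -/
theorem IsHypersurfaceCutOutBy.nonempty_iso {N : ℕ} {F : MvPolynomial (Fin (N + 1)) k}
    {X X' : SchemeOver k} (h : IsHypersurfaceCutOutBy N F X) (h' : IsHypersurfaceCutOutBy N F X') :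
    Nonempty (X ≅ X') := by
  haveI : IsClosedImmersion h.2.choose.left := h.2.choose_spec.1
  haveI : IsClosedImmersion h'.2.choose.left := h'.2.choose_spec.1
  obtain ⟨e, -⟩ := h.exists_iso_comp_eq h' h.2.choose h.2.choose_spec.2 h'.2.choose h'.2.choose_spec.2
  exact ⟨e⟩

end Uniqueness

namespace SmoothHypersurface

attribute [local instance] MvPolynomial.gradedAlgebra

variable {n : ℕ}

/-! ### `X_F` is cut out by `F`, for every form `F` -/

/-- **`X_F = V₊(F)` is cut out by `F`** in the sense of `Motives.IsHypersurfaceCutOutBy`, for EVERY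
form `F`: it is reduced (reduced induced structure, `instIsReducedLeftHypersurface`) and
`hypersurfaceι F` is a closed `k`-immersion with image `V₊(F)` (`range_hypersurfaceι`). The tree's
`isHypersurfaceCutOutBy_hypersurface` is the case of a nonsingular form of positive degree
(reducedness via smoothness). Hartshorne II Example 3.2.6. [cite: Hartshorne1977, II Example 3.2.6] -/
theorem isHypersurfaceCutOutBy_self (F : MvPolynomial (Fin (n + 2)) k) :
    IsHypersurfaceCutOutBy (n + 1) F (hypersurface F) :=
  ⟨inferInstance, hypersurfaceι F, inferInstance, range_hypersurfaceι F⟩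

/-- **Every `k`-scheme cut out by `F` is `k`-isomorphic to `X_F`.** [cite: Hartshorne1977, II Ex. 3.11 (d)] -/
theorem _root_.Literature.AlgebraicGeometry.Motives.IsHypersurfaceCutOutBy.nonempty_iso_hypersurface
    {F : MvPolynomial (Fin (n + 2)) k} {X : SchemeOver k} (h : IsHypersurfaceCutOutBy (n + 1) F X) :
    Nonempty (X ≅ hypersurface F) :=
  h.nonempty_iso (isHypersurfaceCutOutBy_self F)

/-! ### The standard model of the Fermat variety -/

variable (k) in
/-- **The standard model `V₊(Σᵢ xᵢᵐ) ⊂ ℙⁿ⁺¹_k` IS a Fermat variety** in the sense of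
`Motives.IsFermatVariety n m` — for all `n`, `m` and every field `k` (Shioda's `Xⁿₘ` "defined by
the equation `x₀ᵐ + ⋯ + x_{n+1}ᵐ = 0`"). [cite: Shioda1979PJA, §1 eq. (1)] -/
theorem isFermatVariety_hypersurface_fermatPolynomial (n m : ℕ) :
    IsFermatVariety n m (hypersurface (fermatPolynomial k n m)) :=
  isHypersurfaceCutOutBy_self _

variable {m : ℕ}

/-- **The standard model is a smooth hypersurface of dimension `n` and degree `m`** for `n ≥ 1`,
`m ≥ 1`, `m ≠ 0` in `k`, and `ζ ∈ k` with `ζᵐ = -1`: the Fermat form is homogeneous of degree `m`,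
nonsingular by the Jacobian criterion (`∂ᵢ = m xᵢ^{m-1}`, `isNonsingularForm_sum_X_pow`) and
irreducible over every overfield by Eisenstein at `(ζ, 1, 0, …, 0)` (`irreducible_sum_X_pow`), so
`isSmoothHypersurface_hypersurface` applies. Hartshorne I Ex. 5.5, II Example 8.20.2 — the
argument of the tree's `exists_isSmoothHypersurface_holds`, with the witness named.
[cite: Hartshorne1977, I Ex. 5.5 and II Example 8.20.2] -/
theorem isSmoothHypersurface_hypersurface_fermatPolynomial (hn : 1 ≤ n) (hm : 1 ≤ m)
    (hmk : (m : k) ≠ 0) {ζ : k} (hζ : ζ ^ m = -1) :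
    IsSmoothHypersurface n m (hypersurface (fermatPolynomial k n m)) := by
  refine isSmoothHypersurface_hypersurface _ (isHomogeneous_fermatPolynomial n m) hm
    (isNonsingularForm_sum_X_pow hmk) fun K _ _ ↦ ?_
  rw [map_fermatPolynomial]
  refine irreducible_sum_X_pow hn hm (fun h ↦ hmk ?_) (algebraMap k K ζ)
    (by rw [← map_pow, hζ, map_neg, map_one])
  have : algebraMap k K m = algebraMap k K 0 := by rw [map_natCast, map_zero, h]
  exact (algebraMap k K).injective this

/-- Over an algebraically closed field in which `m ≠ 0` (`n ≥ 1`, `m ≥ 1`) the standard model is a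
smooth hypersurface of dimension `n` and degree `m` (`-1` is an `m`-th power). Shioda's standing
hypothesis `p ∤ m` for `Xⁿₘ(p)`. [cite: Hartshorne1977, I Ex. 5.5 and II Example 8.20.2]
[cite: Shioda1979PJA, §1 eq. (1)] -/
theorem isSmoothHypersurface_hypersurface_fermatPolynomial_of_isAlgClosed [IsAlgClosed k]
    (hn : 1 ≤ n) (hm : 1 ≤ m) (hmk : (m : k) ≠ 0) :
    IsSmoothHypersurface n m (hypersurface (fermatPolynomial k n m)) := by
  obtain ⟨ζ, hζ⟩ : ∃ ζ : k, ζ ^ m = -1 := IsAlgClosed.exists_pow_nat_eq (-1) hm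
  exact isSmoothHypersurface_hypersurface_fermatPolynomial hn hm hmk hζ

/-- Over an algebraically closed field of characteristic `0` (e.g. `ℂ`) the standard model is a
smooth hypersurface of dimension `n` and degree `m` for `n ≥ 1`, `m ≥ 1`. Over `ℂ` this is
`isSmoothHypersurface_fermatHypersurface` of `HodgeTheory/FermatHypersurfaceReduction` (by `rfl`).
[cite: Hartshorne1977, I Ex. 5.5 and II Example 8.20.2] -/
theorem isSmoothHypersurface_hypersurface_fermatPolynomial_of_charZero [IsAlgClosed k] [CharZero k]
    (hn : 1 ≤ n) (hm : 1 ≤ m) : IsSmoothHypersurface n m (hypersurface (fermatPolynomial k n m)) :=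
  isSmoothHypersurface_hypersurface_fermatPolynomial_of_isAlgClosed hn hm (Nat.cast_ne_zero.2 (by omega))

/-- The standard model is smooth projective of dimension `n` (`k` algebraically closed, `n ≥ 1`,
`m ≥ 1`, `m ≠ 0` in `k`). [cite: Hartshorne1977, I Ex. 5.5 and II Example 8.20.2] -/
theorem isSmoothProjective_hypersurface_fermatPolynomial [IsAlgClosed k] (hn : 1 ≤ n) (hm : 1 ≤ m)
    (hmk : (m : k) ≠ 0) : IsSmoothProjective n (hypersurface (fermatPolynomial k n m)) :=
  (isSmoothHypersurface_hypersurface_fermatPolynomial_of_isAlgClosed hn hm hmk).1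

/-- The standard model is smooth projective of dimension `n` (`k` algebraically closed of
characteristic `0`, `n ≥ 1`, `m ≥ 1`); over `ℂ` this is `isSmoothProjective_fermatHypersurface` of
`HodgeTheory/FermatHypersurfaceReduction` (by `rfl`). [cite: Hartshorne1977, I Ex. 5.5 and II Example 8.20.2] -/
theorem isSmoothProjective_hypersurface_fermatPolynomial_of_charZero [IsAlgClosed k] [CharZero k]
    (hn : 1 ≤ n) (hm : 1 ≤ m) : IsSmoothProjective n (hypersurface (fermatPolynomial k n m)) :=
  (isSmoothHypersurface_hypersurface_fermatPolynomial_of_charZero hn hm).1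

end SmoothHypersurface

/-! ### Abstract Fermat varieties -/

namespace IsFermatVariety

variable {n m : ℕ} {X X' : SchemeOver k}

/-- **Every Fermat variety is `k`-isomorphic to the standard model `V₊(Σᵢ xᵢᵐ)`** (uniqueness of
the reduced induced structure; over `ℂ` the isomorphism `IsFermatVariety.isoFermatHypersurface` of
`HodgeTheory/FermatHypersurfaceReduction` is such an `e`). [cite: Hartshorne1977, II Ex. 3.11 (d)]
[cite: Shioda1979PJA, §1 eq. (1)] -/
theorem nonempty_iso_hypersurface (hF : IsFermatVariety n m X) :
    Nonempty (X ≅ SmoothHypersurface.hypersurface (fermatPolynomial k n m)) :=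
  IsHypersurfaceCutOutBy.nonempty_iso_hypersurface hF

/-- **Two Fermat varieties `Xⁿₘ` over `k` are `k`-isomorphic.** [cite: Hartshorne1977, II Ex. 3.11 (d)] -/
theorem nonempty_iso (hF : IsFermatVariety n m X) (hF' : IsFermatVariety n m X') : Nonempty (X ≅ X') :=
  IsHypersurfaceCutOutBy.nonempty_iso hF hF'

/-- **A smooth projective Fermat variety is a smooth hypersurface** of dimension `n` and degree `m`
(`Motives.IsSmoothHypersurface`, which asks for an irreducible defining form): for `n ≥ 1`, `m ≥ 1`,
`m ≠ 0` in `k` and `ζᵐ = -1` the Fermat form is homogeneous of degree `m` and irreducible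
(`SmoothHypersurface.irreducible_sum_X_pow`). Over `ℂ` compare
`HodgeTheory.isSmoothHypersurface_of_isFermatVariety` (`FermatHodgeConjectureProofs`).
[cite: Hartshorne1977, I Ex. 5.5 and II Example 8.20.2] -/
theorem isSmoothHypersurface (hF : IsFermatVariety n m X) (hX : IsSmoothProjective n X) (hn : 1 ≤ n)
    (hm : 1 ≤ m) (hmk : (m : k) ≠ 0) {ζ : k} (hζ : ζ ^ m = -1) : IsSmoothHypersurface n m X :=
  ⟨hX, fermatPolynomial k n m, isHomogeneous_fermatPolynomial n m,
    SmoothHypersurface.irreducible_sum_X_pow hn hm hmk ζ hζ, hF⟩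

/-- A smooth projective Fermat variety over an algebraically closed field with `m ≠ 0` in `k`
(`n ≥ 1`, `m ≥ 1`) is a smooth hypersurface of degree `m`. [cite: Hartshorne1977, I Ex. 5.5 and II Example 8.20.2] -/
theorem isSmoothHypersurface_of_isAlgClosed [IsAlgClosed k] (hF : IsFermatVariety n m X)
    (hX : IsSmoothProjective n X) (hn : 1 ≤ n) (hm : 1 ≤ m) (hmk : (m : k) ≠ 0) :
    IsSmoothHypersurface n m X := by
  obtain ⟨ζ, hζ⟩ : ∃ ζ : k, ζ ^ m = -1 := IsAlgClosed.exists_pow_nat_eq (-1) hm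
  exact hF.isSmoothHypersurface hX hn hm hmk hζ

/-- A smooth projective Fermat variety over an algebraically closed field of characteristic `0`
(`n ≥ 1`, `m ≥ 1`) is a smooth hypersurface of degree `m`. [cite: Hartshorne1977, I Ex. 5.5 and II Example 8.20.2] -/
theorem isSmoothHypersurface_of_charZero [IsAlgClosed k] [CharZero k] (hF : IsFermatVariety n m X)
    (hX : IsSmoothProjective n X) (hn : 1 ≤ n) (hm : 1 ≤ m) : IsSmoothHypersurface n m X :=
  hF.isSmoothHypersurface_of_isAlgClosed hX hn hm (Nat.cast_ne_zero.2 (by omega))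

end IsFermatVariety

end Literature.AlgebraicGeometry.Motives

end
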